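import Literature.NumberTheory.Automorphic.UnitarySimilitudeCentralTorusDecomposition
import Mathlib.LinearAlgebra.Complex.Module
import Mathlib.LinearAlgebra.Matrix.Charpoly.Basic
import Mathlib.RingTheory.Complex
import HarnessLib

/-!
# The Shimura homomorphisms `h_{G^ℚ,φ}`, `h_{Z^ℚ}`, `h_{G̃}` of Rapoport–Smithling–Zhang on real points:
# `h(√-1) = √-1 J_φ`, multiplier `|z|²`, Kottwitz positivity, and `h_{G,φ₀}(z) = diag(z/z̄, 1, …, 1)`

Topic `NumberTheory/Automorphic`, namespace `Literature.NumberTheory.Automorphic.UnitaryShimuraDatum` (lane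
`lit-hodgefound`, Track 2 foundations; seat `lit-hodgefound-p11`, generation 31, row g31-#2).  THEOREMS ONLY
(D-0026): no definition, no named fact, no instance, no notation.  The archimedean component of the PEL / unitary
Shimura data of [RapoportSmithlingZhang2017] §3.1, ON REAL POINTS, in the tower `ℝ →ι ℂ ⟲ conj` of
✔ `Automorphic/UnitarySimilitudeNormTorus` (g30-#4: `GU(J)(A) ≤ GL_n(R) × Aˣ` by membership `hG`) and
✔ `Automorphic/UnitarySimilitudeCentralTorusDecomposition` (g30-#5: `G̃(A) ≤ Rˣ × (GL_n(R) × Aˣ)` by membership `hGt`,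
`G̃ ≅ Z^ℚ × U(W)`, `(z, g) ↦ (z, z⁻¹ g)`).  The matrices enter through their defining formulas (hypotheses `hJ`, `hh`),
so that no definition is needed.

## The print, verbatim (arXiv 1710.06962v3 = Compositio Math. 156 (2020), §3.1; held text `paper:arxiv-1710.06962`
p0009 L5–L45, p0010 L14–L28)

«We assume that the hermitian space `W` has the following signatures at the archimedean places of `F₀`: for a
distinguished element `φ₀ ∈ Φ`, the signature of `W_{φ₀}` is `(1, n−1)`, and for all other `φ ∈ Φ` the signature of
`W_φ` is `(0, n)`. […] it suffices to define the components `h_{G^ℚ,φ}` of `h_{G^ℚ}` […]. We define matrices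
`J_φ := diag(1, (−1)^{(n−1)})`, `φ = φ₀`; `diag(−1, −1, …, −1)`, `φ ∈ Φ ∖ {φ₀}` […] such that the hermitian forms on
`W_φ` […] have respective normal forms `(x, y)_φ = ᵗx J_φ ȳ` […]. We then define the component maps
`h_{G^ℚ,φ} : ℂ^× → GU(W_φ)(ℝ)` […] to be induced by the respective `ℝ`-algebra homomorphisms `ℂ → End(W_φ)`,
`√−1 ↦ √−1 J_φ` […]. By definition of `Φ`, the form `⟨x, y⟩_φ := Tr_{ℂ/ℝ} (φ(√Δ))⁻¹ (h_{G^ℚ,φ}(√−1) x, y)_φ` is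
symmetric and positive definite on `W_φ` for each `φ ∈ Φ` […]. note that `Φ` induces an identification
`Z^ℚ(ℝ) ≅ {(z_φ) ∈ (ℂ^×)^Φ | |z_φ| = |z_{φ'}| for all φ, φ' ∈ Φ}`. In this way, we define `h_{Z^ℚ} : ℂ^× → Z^ℚ(ℝ)`
to be the diagonal embedding, pre-composed with complex conjugation. We then obtain the desired Shimura data by
defining the Shimura homomorphisms […] `h_{G̃} : ℂ^× → G̃(ℝ)`, `z ↦ (h_{Z^ℚ}(z), h_{G^ℚ}(z))`.»  Here (Notation, p0006
L10–L12) «`Φ := {φ : F → ℂ | φ(√Δ) ∈ ℝ_{>0} · √−1}`», so `φ(√Δ) = √−1 r_φ` with `r_φ > 0`.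

Remark 3.2 (p0010 L14–L22): «In terms of the product decomposition `G̃_ℝ ≅ Z^ℚ_ℝ × ∏_φ U(W_φ)` induced by (2.?),
the conjugacy class `{h_{G̃}}` is the product of `{h_{Z^ℚ}}` with the `U(W_φ)(ℝ)`-conjugacy class `{h_{G,φ}}` for each
`φ ∈ Φ` […]. The conjugacy class `{h_{Z^ℚ}}` consists of a single element; so does `{h_{G,φ}}` for `φ ≠ φ₀`, since in
this case `h_{G,φ}` is the trivial cocharacter. For `φ = φ₀`, in terms of the basis for `W_{φ₀}` chosen above,
`h_{G,φ₀}` is the cocharacter `z ↦ diag(z/z̄, 1, …, 1)`. The conjugacy class `{h_{G,φ₀}}` then identifies with the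
open subset `𝒟_{φ₀} ⊂ ℙ(W_{φ₀})(ℂ)` of positive-definite lines for the hermitian form (send `h ∈ {h_{G,φ₀}}` to the
`−1`-eigenspace of `h(√−1)` […]).»

## What is formalised (index type `m`, distinguished index `i₀ : m`; `J_{φ₀} = diag(1_{i₀}, −1 elsewhere)`,
## `h_{φ₀}(z) = diag(z at i₀, z̄ elsewhere)`; `J_φ = −1`, `h_φ(z) = z̄ · 1` for `φ ≠ φ₀`; pairing `(x, y) = Σ xᵢ Jᵢᵢ ȳᵢ`)

* §1 the matrices: `mul_self_of_eq_signDiagonal` (`J² = 1`), `map_conj_transpose_of_eq_signDiagonal` (hermitian, real);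
  `I_smul_mul_I_smul` (`(√−1 J)² = −1` whenever `J² = 1`).
* §2 **`liftAux_I_smul_apply`** (THE `ℝ`-algebra homomorphism `ℂ → M_n(ℂ)` «induced by `√−1 ↦ √−1 J_φ`», Mathlib's
  `Complex.liftAux`, is `z ↦ Re z · 1 + Im z · √−1 J`), `liftAux_I_smul_apply_I` (`h(√−1) = √−1 J`),
  **`liftAux_I_smul_eq_of_eq_signDiagonal`** (`= h_{φ₀}(z) = diag(z, z̄, …, z̄)`), `liftAux_I_smul_neg_one` (`φ ≠ φ₀`:
  `h_φ(z) = z̄ · 1`).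
* §3 **`map_conj_transpose_mul_mul_eq_normSq_smul`** (`ᵗh̄(z) J h(z) = |z|² J`: `h(z)` is a unitary SIMILITUDE with
  multiplier `|z|² = Nm_{ℂ/ℝ}(z)`), **`exists_monoidHom_mem`** (`h_{G^ℚ,φ₀} : ℂ^× → GU(W_{φ₀})(ℝ)` as a homomorphism
  into g30-#4's group on `ℝ`-points, components `(h(z), |z|²)`), `conj_mul_conj_conj_eq_normSq` and
  **`exists_monoidHom_mem_tilde`** (`h_{G̃} = (h_{Z^ℚ}, h_{G^ℚ})`, `h_{Z^ℚ}(z) = z̄`: `Nm(z̄) = |z|² = c(h(z))`, so `h_{G̃}`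
  lands in g30-#5's `G̃(ℝ)`), and the `φ ≠ φ₀` companions `conj_smul_one_similitude` / `exists_monoidHom_mem_of_neg_one`.
* §4 KOTTWITZ POSITIVITY «by definition of `Φ`»: `pairing_J_h_I` (`(J(√−1 J)x, y) = √−1 (x, ȳ)·` — for any `J² = 1`),
  **`form_eq`** (`⟨x, y⟩_φ = Tr_{ℂ/ℝ}((√−1 r)⁻¹ (h(√−1)x, y)_φ) = (2/r) Re Σ xᵢ ȳᵢ`, with Mathlib's `Algebra.trace ℝ ℂ`),
  **`form_symm`**, **`form_pos`** (symmetric, positive definite for `r > 0`) and `form_neg_of_neg` (for the conjugate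
  places, `φ(√Δ) ∈ ℝ_{<0}√−1`, the same form is NEGATIVE definite — why `Φ` is chosen as it is).
* §5 REMARK 3.2: **`inv_conj_smul_h_eq`** (`z̄⁻¹ h_{φ₀}(z) = diag(z/z̄, 1, …, 1) = h_{G,φ₀}(z)`),
  `map_conj_transpose_mul_mul_of_unitary_diag` (it is UNITARY), `inv_conj_smul_conj_smul_one` (`φ ≠ φ₀`:
  `z̄⁻¹ h_φ(z) = 1`, «the trivial cocharacter»), **`tilde_prod_snd_eq`** (under ANY isomorphism `G̃ ≅ Z^ℚ × U(W)` with
  g30-#5's formula `(z, g) ↦ (z, z⁻¹g)`, the `U`-component of `h_{G̃,φ₀}(z)` is `diag(z/z̄, 1, …, 1)`),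
  **`hG_I_eq`** (`h_{G,φ₀}(√−1) = diag(−1, 1, …, 1)`), **`mulVec_eq_neg_iff`** (its `−1`-eigenspace is the line
  `ℂ e_{i₀}`), **`pairing_pos_of_line`** (that line is POSITIVE DEFINITE for `(·,·)_{φ₀}` — the base point of `𝒟_{φ₀}`),
  `pairing_neg_of_apply_eq_zero` (the complementary coordinate hyperplane is negative: signature `(1, n−1)`), `charpoly_h` (`χ_{h(z)} = (X − z)(X − z̄)^{n−1}`: the eigenvalue `z` has multiplicity `1 =` the positive index of
  `J_{φ₀}` — Kottwitz's `(p, q) = (1, n−1)`).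

Not formalised: the identification `{h_{G,φ₀}} ≅ 𝒟_{φ₀} ≅` unit ball (the tree's `Motives/UnitaryPeriodDomain*`,
`Weil1964/ArchUnitaryBallTransitive` treat the ball), Deligne's axioms (2.1.1.1–3) for `(G̃, h_{G̃})`, the reflex field
(✔ `ComplexMultiplication/CMTypeDistinguishedElementReflexField`, eq. (3.1)).

## References

* [RapoportSmithlingZhang2017] M. Rapoport, B. Smithling, W. Zhang, *Arithmetic diagonal cycles on unitary Shimura
  varieties*, Compositio Math. 156 (2020) 1745–1824 = arXiv 1710.06962, §3.1 and Remark 3.2.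
* [Kottwitz1992] R. E. Kottwitz, *Points on some Shimura varieties over finite fields*, J. Amer. Math. Soc. 5
  (1992), §4 pp. 387–389 (`(B, *, V, (·,·), h)`, `(v, h(i)w)` positive definite), §5 p. 390.
* [Deligne1979ShimuraVarieties] P. Deligne, *Variétés de Shimura*, Proc. Symp. Pure Math. 33.2 (1979), 2.1.1.
-/

open scoped Matrix ComplexConjugate

namespace Literature.NumberTheory.Automorphic.UnitaryShimuraDatum

open Complex Matrix

variable {m : Type*} [Fintype m] [DecidableEq m]

/-! ## §1 The matrices `J_{φ₀} = diag(1, −1, …, −1)` and `J_φ = −1` -/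

/-- `J_{φ₀}² = 1`. [cite: RapoportSmithlingZhang2017, §3.1] -/
theorem mul_self_of_eq_signDiagonal (i₀ : m) {J : Matrix m m ℂ}
    (hJ : J = Matrix.diagonal fun i => if i = i₀ then (1 : ℂ) else -1) : J * J = 1 := by
  subst hJ
  rw [Matrix.diagonal_mul_diagonal, ← Matrix.diagonal_one]
  congr 1
  funext i
  split_ifs <;> norm_num

omit [Fintype m] in
/-- `J_{φ₀}` is hermitian (indeed real symmetric): `ᵗJ̄ = J`. [cite: RapoportSmithlingZhang2017, §3.1] -/
theorem map_conj_transpose_of_eq_signDiagonal (i₀ : m) {J : Matrix m m ℂ}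
    (hJ : J = Matrix.diagonal fun i => if i = i₀ then (1 : ℂ) else -1) : (J.map (starRingEnd ℂ))ᵀ = J := by
  subst hJ
  rw [Matrix.diagonal_map (map_zero _), Matrix.diagonal_transpose]
  congr 1
  funext i
  split_ifs <;> simp

omit [DecidableEq m] in
/-- A matrix with `J² = 1` has `det J ≠ 0` (`det J = ±1`). [folklore] -/
private theorem det_ne_zero_of_mul_self_eq_one [DecidableEq m] {J : Matrix m m ℂ} (hJJ : J * J = 1) : J.det ≠ 0 := by
  intro h
  have h1 := congrArg Matrix.det hJJ
  rw [Matrix.det_mul, h, mul_zero, Matrix.det_one] at h1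
  exact zero_ne_one h1

omit [DecidableEq m] in
/-- `(√−1 J)² = −1` whenever `J² = 1`: `√−1 J` is a complex structure on `W_φ ⊗ ℝ`, so «`√−1 ↦ √−1 J_φ`» does define an
`ℝ`-algebra homomorphism `ℂ → End(W_φ)`. [cite: RapoportSmithlingZhang2017, §3.1] -/
theorem I_smul_mul_I_smul [DecidableEq m] {J : Matrix m m ℂ} (hJJ : J * J = 1) : (I • J) * (I • J) = -1 := by
  rw [Matrix.smul_mul, Matrix.mul_smul, smul_smul, hJJ, I_mul_I, neg_smul, one_smul]

/-! ## §2 `h_{G^ℚ,φ}` = the `ℝ`-algebra homomorphism `ℂ → M_n(ℂ)` with `√−1 ↦ √−1 J_φ` -/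

/-- **The `ℝ`-algebra homomorphism induced by `√−1 ↦ √−1 J`** (Mathlib's `Complex.liftAux`) is
`z ↦ Re z · 1 + Im z · √−1 J`. [cite: RapoportSmithlingZhang2017, §3.1] -/
theorem liftAux_I_smul_apply {J : Matrix m m ℂ} (hJJ : J * J = 1) (z : ℂ) :
    Complex.liftAux (I • J) (I_smul_mul_I_smul hJJ) z = (z.re : ℂ) • (1 : Matrix m m ℂ) + ((z.im : ℂ) * I) • J := by
  rw [Complex.liftAux_apply, Algebra.algebraMap_eq_smul_one, ← algebraMap_smul ℂ z.re (1 : Matrix m m ℂ),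
    ← algebraMap_smul ℂ z.im (I • J), smul_smul]
  rfl

/-- `h(√−1) = √−1 J` (the defining property). [cite: RapoportSmithlingZhang2017, §3.1] -/
theorem liftAux_I_smul_apply_I {J : Matrix m m ℂ} (hJJ : J * J = 1) :
    Complex.liftAux (I • J) (I_smul_mul_I_smul hJJ) I = I • J :=
  Complex.liftAux_apply_I _ _

/-- **`h_{G^ℚ,φ₀}(z) = diag(z, z̄, …, z̄)`** (`z` at the distinguished index `i₀`, `z̄` elsewhere): the homomorphism induced
by `√−1 ↦ √−1 J_{φ₀}`, `J_{φ₀} = diag(1, −1, …, −1)`, in the chosen basis of `W_{φ₀}`.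
[cite: RapoportSmithlingZhang2017, §3.1] -/
theorem liftAux_I_smul_eq_of_eq_signDiagonal (i₀ : m) {J : Matrix m m ℂ}
    (hJ : J = Matrix.diagonal fun i => if i = i₀ then (1 : ℂ) else -1) (z : ℂ) :
    Complex.liftAux (I • J) (I_smul_mul_I_smul (mul_self_of_eq_signDiagonal i₀ hJ)) z =
      Matrix.diagonal fun i => if i = i₀ then z else conj z := by
  rw [liftAux_I_smul_apply (mul_self_of_eq_signDiagonal i₀ hJ)]
  subst hJ
  rw [← Matrix.diagonal_one, ← Matrix.diagonal_smul, ← Matrix.diagonal_smul, Matrix.diagonal_add]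
  congr 1
  funext i
  simp only [Pi.smul_apply, smul_eq_mul, mul_one]
  split_ifs with hi
  · rw [mul_one]
    exact Complex.re_add_im z
  · apply Complex.ext <;> simp

/-- **`φ ≠ φ₀`: `h_{G^ℚ,φ}(z) = z̄ · 1`** — the homomorphism induced by `√−1 ↦ √−1 J_φ` with `J_φ = −1`, i.e.
`√−1 ↦ −√−1`: complex conjugation followed by the structure map. [cite: RapoportSmithlingZhang2017, §3.1] -/
theorem liftAux_I_smul_neg_one (z : ℂ) :
    Complex.liftAux (I • (-1 : Matrix m m ℂ)) (I_smul_mul_I_smul (by rw [neg_mul_neg, one_mul])) z =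
      conj z • (1 : Matrix m m ℂ) := by
  rw [liftAux_I_smul_apply (by rw [neg_mul_neg, one_mul]), smul_neg, ← neg_smul, ← add_smul]
  congr 1
  apply Complex.ext <;> simp

/-! ## §3 `h_{G^ℚ,φ}` lands in `GU(W_φ)(ℝ)` with multiplier `|z|²`; `h_{G̃} = (h_{Z^ℚ}, h_{G^ℚ})` lands in `G̃(ℝ)` -/

/-- `ᵗ(conj diag(d)) · diag(s) · diag(d) = diag(d̄ᵢ sᵢ dᵢ)`. [folklore] -/
private theorem map_conj_transpose_diagonal_mul (d s : m → ℂ) :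
    ((Matrix.diagonal d).map (starRingEnd ℂ))ᵀ * Matrix.diagonal s * Matrix.diagonal d =
      Matrix.diagonal fun i => conj (d i) * s i * d i := by
  rw [Matrix.diagonal_map (map_zero _), Matrix.diagonal_transpose, Matrix.diagonal_mul_diagonal,
    Matrix.diagonal_mul_diagonal]

/-- **`h_{G^ℚ,φ₀}(z)` is a unitary similitude of `J_{φ₀}` with multiplier `|z|² = Nm_{ℂ/ℝ}(z)`**:
`ᵗh̄(z) J h(z) = |z|² J` — i.e. `h_{G^ℚ,φ₀}(z) ∈ GU(W_{φ₀})(ℝ)` with `c(h(z)) = |z|²`. [cite: RapoportSmithlingZhang2017, §3.1] -/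
theorem map_conj_transpose_mul_mul_eq_normSq_smul (i₀ : m) {J : Matrix m m ℂ}
    (hJ : J = Matrix.diagonal fun i => if i = i₀ then (1 : ℂ) else -1) {h : ℂ → Matrix m m ℂ}
    (hh : ∀ z, h z = Matrix.diagonal fun i => if i = i₀ then z else conj z) (z : ℂ) :
    ((h z).map (starRingEnd ℂ))ᵀ * J * h z = ((Complex.normSq z : ℝ) : ℂ) • J := by
  rw [hh, hJ, map_conj_transpose_diagonal_mul, ← Matrix.diagonal_smul]
  congr 1
  funext i
  simp only [Pi.smul_apply, smul_eq_mul]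
  split_ifs
  · rw [mul_one, mul_one, Complex.normSq_eq_conj_mul_self]
  · rw [Complex.conj_conj, mul_neg_one, neg_mul, mul_neg_one, Complex.mul_conj]

/-- `φ ≠ φ₀`: `h_φ(z) = z̄ · 1` is a similitude of `J_φ = −1` (indeed of any `J`) with multiplier `|z|²`.
[cite: RapoportSmithlingZhang2017, §3.1] -/
theorem conj_smul_one_similitude (J : Matrix m m ℂ) (z : ℂ) :
    ((conj z • (1 : Matrix m m ℂ)).map (starRingEnd ℂ))ᵀ * J * (conj z • (1 : Matrix m m ℂ)) =
      ((Complex.normSq z : ℝ) : ℂ) • J := by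
  have hmap : (conj z • (1 : Matrix m m ℂ)).map (starRingEnd ℂ) = z • (1 : Matrix m m ℂ) := by
    rw [Matrix.smul_one_eq_diagonal, Matrix.smul_one_eq_diagonal, Matrix.diagonal_map (map_zero _)]
    congr 1
    funext i
    simp
  rw [hmap, Matrix.transpose_smul, Matrix.transpose_one, Matrix.smul_mul, Matrix.one_mul, Matrix.mul_smul,
    Matrix.mul_one, smul_smul, ← Complex.normSq_eq_conj_mul_self]

/-- **`h_{G^ℚ,φ₀} : ℂ^× → GU(W_{φ₀})(ℝ)` as a homomorphism on points**: in the tower `ℝ → ℂ ⟲ conj` of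
✔ `UnitarySimilitudeNormTorus` (`GU(J)(ℝ) = {(g, t) ∈ GL_n(ℂ) × ℝˣ : ᵗḡ J g = t J}` by membership), `z ↦ (h(z), |z|²)` is a
group homomorphism `ℂ^× → GU(J_{φ₀})(ℝ)`. [cite: RapoportSmithlingZhang2017, §3.1] [cite: Kottwitz1992, §5 p. 390] -/
theorem exists_monoidHom_mem (i₀ : m) {J : Matrix m m ℂ}
    (hJ : J = Matrix.diagonal fun i => if i = i₀ then (1 : ℂ) else -1) {G : Subgroup (GL m ℂ × ℝˣ)}
    (hG : ∀ p, p ∈ G ↔ ((p.1 : Matrix m m ℂ).map (starRingEnd ℂ))ᵀ * J * (p.1 : Matrix m m ℂ) =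
      (algebraMap ℝ ℂ) (p.2 : ℝ) • J) :
    ∃ η : ℂˣ →* G, ∀ z : ℂˣ,
      (((η z : G) : GL m ℂ × ℝˣ).1 : Matrix m m ℂ) = Matrix.diagonal (fun i => if i = i₀ then (z : ℂ) else conj (z : ℂ)) ∧
        (((η z : G) : GL m ℂ × ℝˣ).2 : ℝ) = Complex.normSq (z : ℂ) := by
  have hJJ := mul_self_of_eq_signDiagonal i₀ hJ
  let η₀ : ℂˣ →* GL m ℂ × ℝˣ :=
    MonoidHom.prod (Units.map ((Complex.liftAux (I • J) (I_smul_mul_I_smul hJJ) : ℂ →ₐ[ℝ] Matrix m m ℂ) :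
        ℂ →* Matrix m m ℂ))
      (Units.map (Complex.normSq : ℂ →* ℝ))
  have h1 : ∀ z : ℂˣ, ((η₀ z).1 : Matrix m m ℂ) = Matrix.diagonal (fun i => if i = i₀ then (z : ℂ) else conj (z : ℂ)) :=
    fun z => liftAux_I_smul_eq_of_eq_signDiagonal i₀ hJ (z : ℂ)
  have h2 : ∀ z : ℂˣ, ((η₀ z).2 : ℝ) = Complex.normSq (z : ℂ) := fun z => rfl
  have hmem : ∀ z : ℂˣ, η₀ z ∈ G := by
    intro z
    rw [hG, h1, h2, map_conj_transpose_mul_mul_eq_normSq_smul i₀ hJ (fun w => rfl) (z : ℂ)]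
    rfl
  exact ⟨η₀.codRestrict G hmem, fun z => ⟨h1 z, h2 z⟩⟩

/-- `φ ≠ φ₀`: `z ↦ (z̄ · 1, |z|²)` is a homomorphism `ℂ^× → GU(W_φ)(ℝ)` for ANY `J` (central similitudes).
[cite: RapoportSmithlingZhang2017, §3.1] -/
theorem exists_monoidHom_mem_of_neg_one (J : Matrix m m ℂ) {G : Subgroup (GL m ℂ × ℝˣ)}
    (hG : ∀ p, p ∈ G ↔ ((p.1 : Matrix m m ℂ).map (starRingEnd ℂ))ᵀ * J * (p.1 : Matrix m m ℂ) =
      (algebraMap ℝ ℂ) (p.2 : ℝ) • J) :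
    ∃ η : ℂˣ →* G, ∀ z : ℂˣ,
      (((η z : G) : GL m ℂ × ℝˣ).1 : Matrix m m ℂ) = conj (z : ℂ) • (1 : Matrix m m ℂ) ∧
        (((η z : G) : GL m ℂ × ℝˣ).2 : ℝ) = Complex.normSq (z : ℂ) := by
  let η₀ : ℂˣ →* GL m ℂ × ℝˣ :=
    MonoidHom.prod ((Matrix.GeneralLinearGroup.scalar m).comp (Units.map (starRingEnd ℂ : ℂ →* ℂ)))
      (Units.map (Complex.normSq : ℂ →* ℝ))
  have h1 : ∀ z : ℂˣ, ((η₀ z).1 : Matrix m m ℂ) = conj (z : ℂ) • (1 : Matrix m m ℂ) := by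
    intro z
    change ((Matrix.GeneralLinearGroup.scalar m (Units.map (starRingEnd ℂ : ℂ →* ℂ) z) : GL m ℂ) : Matrix m m ℂ) = _
    rw [Matrix.GeneralLinearGroup.coe_scalar, Matrix.scalar_apply, ← Matrix.smul_one_eq_diagonal]
    rfl
  have h2 : ∀ z : ℂˣ, ((η₀ z).2 : ℝ) = Complex.normSq (z : ℂ) := fun z => rfl
  have hmem : ∀ z : ℂˣ, η₀ z ∈ G := by
    intro z
    rw [hG, h1, h2, conj_smul_one_similitude J (z : ℂ)]
    rfl
  exact ⟨η₀.codRestrict G hmem, fun z => ⟨h1 z, h2 z⟩⟩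

/-- `Nm_{ℂ/ℝ}(z̄) = conj(z̄) z̄ = |z|²`: the value of `h_{Z^ℚ}(z) = z̄` has norm the multiplier of `h_{G^ℚ}(z)` — the fibre
condition `Nm(z) = c(g)` of `G̃ = Z^ℚ ×_{𝔾_m} G^ℚ`. [cite: RapoportSmithlingZhang2017, §3.1] -/
theorem conj_mul_conj_conj_eq_normSq (z : ℂ) : conj (conj z) * conj z = ((Complex.normSq z : ℝ) : ℂ) := by
  rw [Complex.conj_conj, Complex.mul_conj]

/-- **`h_{G̃} = (h_{Z^ℚ}, h_{G^ℚ}) : ℂ^× → G̃(ℝ)` on points**, `h_{Z^ℚ}(z) = z̄` («the diagonal embedding, pre-composed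
with complex conjugation»): with g30-#5's `G̃(ℝ) = {(z', (g, t)) : conj(z') z' = t, (g, t) ∈ GU(J)(ℝ)}` by membership,
`z ↦ (z̄, (h_{φ₀}(z), |z|²))` is a homomorphism `ℂ^× → G̃(ℝ)`. [cite: RapoportSmithlingZhang2017, §3.1] -/
theorem exists_monoidHom_mem_tilde (i₀ : m) {J : Matrix m m ℂ}
    (hJ : J = Matrix.diagonal fun i => if i = i₀ then (1 : ℂ) else -1) {G : Subgroup (GL m ℂ × ℝˣ)}
    (hG : ∀ p, p ∈ G ↔ ((p.1 : Matrix m m ℂ).map (starRingEnd ℂ))ᵀ * J * (p.1 : Matrix m m ℂ) =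
      (algebraMap ℝ ℂ) (p.2 : ℝ) • J)
    {Gt : Subgroup (ℂˣ × (GL m ℂ × ℝˣ))}
    (hGt : ∀ q, q ∈ Gt ↔ Units.map (starRingEnd ℂ : ℂ →* ℂ) q.1 * q.1 = Units.map (algebraMap ℝ ℂ : ℝ →* ℂ) q.2.2 ∧
      q.2 ∈ G) :
    ∃ η : ℂˣ →* Gt, ∀ z : ℂˣ,
      (((η z : Gt) : ℂˣ × (GL m ℂ × ℝˣ)).1 : ℂ) = conj (z : ℂ) ∧
      ((((η z : Gt) : ℂˣ × (GL m ℂ × ℝˣ)).2.1 : GL m ℂ) : Matrix m m ℂ) =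
          Matrix.diagonal (fun i => if i = i₀ then (z : ℂ) else conj (z : ℂ)) ∧
        ((((η z : Gt) : ℂˣ × (GL m ℂ × ℝˣ)).2.2 : ℝˣ) : ℝ) = Complex.normSq (z : ℂ) := by
  obtain ⟨η, hη⟩ := exists_monoidHom_mem i₀ hJ hG
  let η₁ : ℂˣ →* ℂˣ × (GL m ℂ × ℝˣ) :=
    MonoidHom.prod (Units.map (starRingEnd ℂ : ℂ →* ℂ)) (G.subtype.comp η)
  have hmem : ∀ z : ℂˣ, η₁ z ∈ Gt := by
    intro z
    rw [hGt]
    refine ⟨Units.ext ?_, (η z).2⟩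
    rw [Units.val_mul, Units.coe_map, MonoidHom.coe_coe, Units.coe_map, MonoidHom.coe_coe]
    change conj (conj (z : ℂ)) * conj (z : ℂ) = (algebraMap ℝ ℂ) ((((η z : G) : GL m ℂ × ℝˣ).2 : ℝˣ) : ℝ)
    rw [(hη z).2, conj_mul_conj_conj_eq_normSq]
    rfl
  exact ⟨η₁.codRestrict Gt hmem, fun z => ⟨rfl, (hη z).1, (hη z).2⟩⟩

/-! ## §4 Kottwitz positivity: `⟨x, y⟩_φ = Tr_{ℂ/ℝ}((φ√Δ)⁻¹ (h(√−1)x, y)_φ)` is symmetric positive definite -/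

/-- `(J (√−1 J) x, ȳ) = √−1 (x, ȳ)` for `J² = 1`: with the hermitian pairing `(x, y)_φ = Σᵢ (J x)ᵢ ȳᵢ` one has
`(h(√−1) x, y)_φ = √−1 Σ xᵢ ȳᵢ`, independently of the signature. [cite: RapoportSmithlingZhang2017, §3.1] -/
theorem pairing_J_h_I {J : Matrix m m ℂ} (hJJ : J * J = 1) (x y : m → ℂ) :
    dotProduct (J *ᵥ ((I • J) *ᵥ x)) (star y) = I * dotProduct x (star y) := by
  rw [Matrix.smul_mulVec, Matrix.mulVec_smul, Matrix.mulVec_mulVec, hJJ, Matrix.one_mulVec,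
    smul_dotProduct, smul_eq_mul]

omit [DecidableEq m] in
/-- `Σ xᵢ x̄ᵢ = Σ |xᵢ|²` is real and non-negative, positive for `x ≠ 0`. [folklore] -/
private theorem dotProduct_star_self_eq (x : m → ℂ) :
    dotProduct x (star x) = ((∑ i, Complex.normSq (x i) : ℝ) : ℂ) := by
  rw [dotProduct, Complex.ofReal_sum]
  exact Finset.sum_congr rfl fun i _ => Complex.mul_conj (x i)

omit [DecidableEq m] in
/-- `0 < Σ |xᵢ|²` for `x ≠ 0`. [folklore] -/
private theorem sum_normSq_pos {x : m → ℂ} (hx : x ≠ 0) : 0 < ∑ i, Complex.normSq (x i) := by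
  obtain ⟨i, hi⟩ : ∃ i, x i ≠ 0 := by
    by_contra h
    push Not at h
    exact hx (funext h)
  exact Finset.sum_pos' (fun j _ => Complex.normSq_nonneg _) ⟨i, Finset.mem_univ _, Complex.normSq_pos.2 hi⟩

/-- **The form `⟨x, y⟩_φ` computed**: for `φ(√Δ) = √−1 r` (`r ∈ ℝ`),
`Tr_{ℂ/ℝ}((√−1 r)⁻¹ (h(√−1) x, y)_φ) = (2/r) Re Σ xᵢ ȳᵢ` (`J² = 1`; Mathlib's `Algebra.trace ℝ ℂ`).
[cite: RapoportSmithlingZhang2017, §3.1] -/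
theorem form_eq {J : Matrix m m ℂ} (hJJ : J * J = 1) (r : ℝ) (x y : m → ℂ) :
    Algebra.trace ℝ ℂ (((I * r)⁻¹ : ℂ) * dotProduct (J *ᵥ ((I • J) *ᵥ x)) (star y)) =
      2 * r⁻¹ * (dotProduct x (star y)).re := by
  rw [pairing_J_h_I hJJ, Algebra.trace_complex_apply]
  by_cases hr : r = 0
  · subst hr; simp
  · have hI : ((I * r)⁻¹ : ℂ) * (I * dotProduct x (star y)) = (r⁻¹ : ℝ) * dotProduct x (star y) := by
      rw [mul_inv, mul_mul_mul_comm, inv_mul_cancel₀ Complex.I_ne_zero, one_mul, Complex.ofReal_inv]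
    rw [hI, Complex.re_ofReal_mul, mul_assoc]

/-- **`⟨x, y⟩_φ` is symmetric.** [cite: RapoportSmithlingZhang2017, §3.1] -/
theorem form_symm {J : Matrix m m ℂ} (hJJ : J * J = 1) (r : ℝ) (x y : m → ℂ) :
    Algebra.trace ℝ ℂ (((I * r)⁻¹ : ℂ) * dotProduct (J *ᵥ ((I • J) *ᵥ x)) (star y)) =
      Algebra.trace ℝ ℂ (((I * r)⁻¹ : ℂ) * dotProduct (J *ᵥ ((I • J) *ᵥ y)) (star x)) := by
  rw [form_eq hJJ, form_eq hJJ]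
  congr 1
  have h : dotProduct y (star x) = conj (dotProduct x (star y)) := by
    rw [dotProduct, dotProduct, map_sum]
    exact Finset.sum_congr rfl fun i _ => by simp [mul_comm]
  rw [h, Complex.conj_re]

/-- **`⟨x, y⟩_φ` is positive definite «by definition of `Φ`»**: for `φ ∈ Φ`, i.e. `φ(√Δ) = √−1 r` with `r > 0`,
`⟨x, x⟩_φ = (2/r) Σ |xᵢ|² > 0` for `x ≠ 0` — Kottwitz's condition «`(v, h(i)w)` is positive definite» for the datum
`(F, *, W_φ, Tr(√Δ)⁻¹(·,·), h_{G^ℚ,φ})`. [cite: RapoportSmithlingZhang2017, §3.1] [cite: Kottwitz1992, §5 p. 390] -/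
theorem form_pos {J : Matrix m m ℂ} (hJJ : J * J = 1) {r : ℝ} (hr : 0 < r) {x : m → ℂ} (hx : x ≠ 0) :
    0 < Algebra.trace ℝ ℂ (((I * r)⁻¹ : ℂ) * dotProduct (J *ᵥ ((I • J) *ᵥ x)) (star x)) := by
  rw [form_eq hJJ, dotProduct_star_self_eq, Complex.ofReal_re]
  exact mul_pos (mul_pos two_pos (inv_pos.2 hr)) (sum_normSq_pos hx)

/-- … and NEGATIVE definite at the conjugate places (`φ(√Δ) = √−1 r` with `r < 0`, i.e. `φ ∉ Φ`): the CM type `Φ` is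
exactly the set of places where Kottwitz's positivity holds for `√−1 ↦ √−1 J_φ`. [cite: RapoportSmithlingZhang2017, §3.1] -/
theorem form_neg_of_neg {J : Matrix m m ℂ} (hJJ : J * J = 1) {r : ℝ} (hr : r < 0) {x : m → ℂ} (hx : x ≠ 0) :
    Algebra.trace ℝ ℂ (((I * r)⁻¹ : ℂ) * dotProduct (J *ᵥ ((I • J) *ᵥ x)) (star x)) < 0 := by
  rw [form_eq hJJ, dotProduct_star_self_eq, Complex.ofReal_re]
  exact mul_neg_of_neg_of_pos (mul_neg_of_pos_of_neg two_pos (inv_lt_zero.2 hr)) (sum_normSq_pos hx)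

/-! ## §5 Remark 3.2: `h_{G,φ₀}(z) = z̄⁻¹ h_{G^ℚ,φ₀}(z) = diag(z/z̄, 1, …, 1)`, its `−1`-eigenline, its type -/

omit [Fintype m] in
/-- **`z̄⁻¹ · h_{G^ℚ,φ₀}(z) = diag(z/z̄, 1, …, 1) = h_{G,φ₀}(z)`** (`z ≠ 0`): the `U(W_{φ₀})`-component of `h_{G̃,φ₀}(z)`
under `G̃ ≅ Z^ℚ × U(W)`, `(z', g) ↦ (z', z'⁻¹ g)` with `z' = h_{Z^ℚ}(z) = z̄`. [cite: RapoportSmithlingZhang2017, Remark 3.2] -/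
theorem inv_conj_smul_h_eq (i₀ : m) {h : ℂ → Matrix m m ℂ}
    (hh : ∀ z, h z = Matrix.diagonal fun i => if i = i₀ then z else conj z) {z : ℂ} (hz : z ≠ 0) :
    (conj z)⁻¹ • h z = Matrix.diagonal fun i => if i = i₀ then z / conj z else 1 := by
  have hcz : conj z ≠ 0 := (map_ne_zero _).2 hz
  rw [hh, ← Matrix.diagonal_smul]
  congr 1
  funext i
  simp only [Pi.smul_apply, smul_eq_mul]
  split_ifs
  · rw [div_eq_inv_mul]
  · rw [inv_mul_cancel₀ hcz]

omit [Fintype m] in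
/-- `φ ≠ φ₀`: `z̄⁻¹ · h_{G^ℚ,φ}(z) = z̄⁻¹ z̄ · 1 = 1` — «in this case `h_{G,φ}` is the trivial cocharacter».
[cite: RapoportSmithlingZhang2017, Remark 3.2] -/
theorem inv_conj_smul_conj_smul_one {z : ℂ} (hz : z ≠ 0) :
    (conj z)⁻¹ • (conj z • (1 : Matrix m m ℂ)) = 1 := by
  rw [smul_smul, inv_mul_cancel₀ ((map_ne_zero _).2 hz), one_smul]

/-- **`h_{G,φ₀}(z) = diag(z/z̄, 1, …, 1)` is UNITARY for `J_{φ₀}`**: `ᵗū J u = J` (`|z/z̄| = 1`) — it lies in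
`U(W_{φ₀})(ℝ)`, as Remark 3.2 says. [cite: RapoportSmithlingZhang2017, Remark 3.2] -/
theorem map_conj_transpose_mul_mul_of_unitary_diag (i₀ : m) {J : Matrix m m ℂ}
    (hJ : J = Matrix.diagonal fun i => if i = i₀ then (1 : ℂ) else -1) {z : ℂ} (hz : z ≠ 0) :
    ((Matrix.diagonal fun i => if i = i₀ then z / conj z else (1 : ℂ)).map (starRingEnd ℂ))ᵀ * J *
        (Matrix.diagonal fun i => if i = i₀ then z / conj z else (1 : ℂ)) = J := by
  have hcz : conj z ≠ 0 := (map_ne_zero _).2 hz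
  rw [hJ, map_conj_transpose_diagonal_mul]
  congr 1
  funext i
  split_ifs
  · rw [map_div₀, Complex.conj_conj, mul_one, div_mul_div_comm, mul_comm (conj z) z, div_self (mul_ne_zero hz hcz)]
  · rw [map_one, one_mul, mul_one]

/-- **Remark 3.2 through g30-#5's isomorphism `G̃ ≅ Z^ℚ × U(W)`**: for ANY isomorphism `e` with the printed formula
`(z', (g, t)) ↦ (z', z'⁻¹ g)` (✔ `UnitarySimilitude.exists_mulEquiv_tilde_prod'`) and any `q ∈ G̃(ℝ)` of the form
`h_{G̃,φ₀}(z) = (z̄, (h_{φ₀}(z), |z|²))`, the `U(W)`-component of `e q` is `diag(z/z̄, 1, …, 1) = h_{G,φ₀}(z)`.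
[cite: RapoportSmithlingZhang2017, Remark 3.2] -/
theorem tilde_prod_snd_eq (i₀ : m) {J : Matrix m m ℂ} {h : ℂ → Matrix m m ℂ}
    (hh : ∀ z, h z = Matrix.diagonal fun i => if i = i₀ then z else conj z)
    {Gt : Subgroup (ℂˣ × (GL m ℂ × ℝˣ))} {Z : Subgroup ℂˣ}
    {e : Gt ≃* Z × unitaryGroupOfForm (starRingEnd ℂ) J}
    (he : ∀ q : Gt, (((e q).1 : Z) : ℂˣ) = (q : ℂˣ × (GL m ℂ × ℝˣ)).1 ∧
      (((e q).2 : unitaryGroupOfForm (starRingEnd ℂ) J) : GL m ℂ) =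
        Matrix.GeneralLinearGroup.scalar m ((q : ℂˣ × (GL m ℂ × ℝˣ)).1)⁻¹ * (q : ℂˣ × (GL m ℂ × ℝˣ)).2.1)
    (q : Gt) (z : ℂˣ) (hq1 : ((q : ℂˣ × (GL m ℂ × ℝˣ)).1 : ℂ) = conj (z : ℂ))
    (hq2 : (((q : ℂˣ × (GL m ℂ × ℝˣ)).2.1 : GL m ℂ) : Matrix m m ℂ) = h z) :
    ((((e q).2 : unitaryGroupOfForm (starRingEnd ℂ) J) : GL m ℂ) : Matrix m m ℂ) =
      Matrix.diagonal fun i => if i = i₀ then (z : ℂ) / conj (z : ℂ) else 1 := by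
  rw [(he q).2, Units.val_mul, Matrix.GeneralLinearGroup.coe_scalar, hq2, Units.val_inv_eq_inv_val, hq1,
    Matrix.scalar_apply, ← Matrix.smul_one_eq_diagonal, Matrix.smul_mul, Matrix.one_mul]
  exact inv_conj_smul_h_eq i₀ hh z.ne_zero

omit [Fintype m] in
/-- **`h_{G,φ₀}(√−1) = diag(−1, 1, …, 1)`** (`√−1 / \overline{√−1} = −1`). [cite: RapoportSmithlingZhang2017, Remark 3.2] -/
theorem hG_I_eq (i₀ : m) :
    (Matrix.diagonal fun i => if i = i₀ then I / conj I else (1 : ℂ)) =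
      Matrix.diagonal fun i => if i = i₀ then (-1 : ℂ) else 1 := by
  congr 1
  funext i
  split_ifs
  · rw [Complex.conj_I, div_neg, div_self Complex.I_ne_zero]
  · rfl

/-- **The `−1`-eigenspace of `h_{G,φ₀}(√−1)` is the line `ℂ e_{i₀}`**: `diag(−1, 1, …, 1) x = −x` iff `xᵢ = 0` for all
`i ≠ i₀` («send `h` to the `−1`-eigenspace of `h(√−1)`»). [cite: RapoportSmithlingZhang2017, Remark 3.2] -/
theorem mulVec_eq_neg_iff (i₀ : m) (x : m → ℂ) :
    (Matrix.diagonal fun i => if i = i₀ then (-1 : ℂ) else 1) *ᵥ x = -x ↔ ∀ i, i ≠ i₀ → x i = 0 := by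
  constructor
  · intro h i hi
    have hi' := congrFun h i
    rw [Matrix.mulVec_diagonal, if_neg hi, one_mul, Pi.neg_apply, eq_neg_iff_add_eq_zero, ← two_mul] at hi'
    exact (mul_eq_zero.1 hi').resolve_left two_ne_zero
  · intro h
    funext i
    rw [Matrix.mulVec_diagonal, Pi.neg_apply]
    split_ifs with hi
    · rw [neg_one_mul]
    · rw [h i hi, mul_zero, neg_zero]

/-- **That line is POSITIVE DEFINITE for `(·,·)_{φ₀}`**: for `x ∈ ℂ e_{i₀}`, `x ≠ 0`, `(x, x)_{φ₀} = Σ (J x)ᵢ x̄ᵢ = |x_{i₀}|² > 0`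
— the base point of `𝒟_{φ₀}`, the set of positive-definite lines. [cite: RapoportSmithlingZhang2017, Remark 3.2] -/
theorem pairing_pos_of_line (i₀ : m) {J : Matrix m m ℂ}
    (hJ : J = Matrix.diagonal fun i => if i = i₀ then (1 : ℂ) else -1) {x : m → ℂ} (hx0 : x ≠ 0)
    (hx : ∀ i, i ≠ i₀ → x i = 0) : 0 < (dotProduct (J *ᵥ x) (star x)).re ∧ (dotProduct (J *ᵥ x) (star x)).im = 0 := by
  have hi₀ : x i₀ ≠ 0 := by
    intro h0
    exact hx0 (funext fun i => by by_cases hi : i = i₀ <;> [exact hi ▸ h0; exact hx i hi])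
  have hsum : dotProduct (J *ᵥ x) (star x) = ((Complex.normSq (x i₀) : ℝ) : ℂ) := by
    rw [dotProduct, Finset.sum_eq_single i₀]
    · rw [hJ, Matrix.mulVec_diagonal, if_pos rfl, one_mul, Pi.star_apply, Complex.star_def, Complex.mul_conj]
    · intro i _ hi
      rw [hJ, Matrix.mulVec_diagonal, hx i hi, mul_zero, zero_mul]
    · intro h; exact absurd (Finset.mem_univ _) h
  rw [hsum, Complex.ofReal_re, Complex.ofReal_im]
  exact ⟨Complex.normSq_pos.2 hi₀, rfl⟩

/-- Conversely the other coordinate lines are NEGATIVE: for `x` supported away from `i₀`, `x ≠ 0`, `(x, x)_{φ₀} < 0` —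
`J_{φ₀}` has signature `(1, n−1)`, «the signature of `W_{φ₀}` is `(1, n−1)`». [cite: RapoportSmithlingZhang2017, §3.1] -/
theorem pairing_neg_of_apply_eq_zero (i₀ : m) {J : Matrix m m ℂ}
    (hJ : J = Matrix.diagonal fun i => if i = i₀ then (1 : ℂ) else -1) {x : m → ℂ} (hx0 : x ≠ 0)
    (hx : x i₀ = 0) : (dotProduct (J *ᵥ x) (star x)).re < 0 := by
  have hsum : dotProduct (J *ᵥ x) (star x) = -(((∑ i, Complex.normSq (x i) : ℝ) : ℂ)) := by
    rw [dotProduct, Complex.ofReal_sum, ← Finset.sum_neg_distrib]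
    refine Finset.sum_congr rfl fun i _ => ?_
    rw [hJ, Matrix.mulVec_diagonal, Pi.star_apply, Complex.star_def]
    split_ifs with hi
    · rw [hi, hx, mul_zero, zero_mul, map_zero, Complex.ofReal_zero, neg_zero]
    · rw [neg_one_mul, neg_mul, Complex.mul_conj]
  rw [hsum, Complex.neg_re, Complex.ofReal_re, neg_lt_zero]
  exact sum_normSq_pos hx0

/-- **The type of `h_{G^ℚ,φ₀}`**: `χ_{h(z)}(X) = (X − z)(X − z̄)^{n−1}` — the eigenvalue `z` occurs with multiplicity `1`
and `z̄` with multiplicity `n − 1`, matching the signature `(1, n−1)` of `W_{φ₀}` (Kottwitz's `(p, q)`: `V₁` is the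
`z`-eigenspace). [cite: RapoportSmithlingZhang2017, §3.1] [cite: Kottwitz1992, §5 p. 390] -/
theorem charpoly_h (i₀ : m) {h : ℂ → Matrix m m ℂ}
    (hh : ∀ z, h z = Matrix.diagonal fun i => if i = i₀ then z else conj z) (z : ℂ) :
    (h z).charpoly = (Polynomial.X - Polynomial.C z) * (Polynomial.X - Polynomial.C (conj z)) ^ (Fintype.card m - 1) := by
  rw [hh, Matrix.charpoly_diagonal, ← Finset.mul_prod_erase Finset.univ _ (Finset.mem_univ i₀), if_pos rfl]
  congr 1
  rw [Finset.prod_congr rfl (fun i hi => by rw [if_neg (Finset.ne_of_mem_erase hi)]), Finset.prod_const,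
    Finset.card_erase_of_mem (Finset.mem_univ _), Finset.card_univ]

end Literature.NumberTheory.Automorphic.UnitaryShimuraDatum
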